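import Summits.QuantumFields.YangMills.Theorems.UnitScaleTiltProp7TwistedSliceGaugeOntoTower
import HarnessLib

/-!
# Route `UnitScaleTilt`, crux K1 child «MinimiserStabilityRegPr» (stmt-QuantumFields-19200), skeleton v10, stub `stub_existenceMinimalOrbit` (EX), route (α) —
# **(ROW-G, gauge-side) THE KERNEL OF THE FRAME-CORRECTED GAUGE OPERATOR IS TANGENT TO THE TWISTED SLICE**: in T2 §5's setting, if a fine gauge parameter `N′` has
# frame-corrected response `𝓚_{A₁}N′ = 0` — in ✓`Prop7FrameLevelOnto.exists_frameCorrected_eq`'s GAUGE-side letters `N′(x̂⁽ᵏ⁾x) − V(x)·ν_k(x)⁻¹ = 0`, `V` the derivative of the accumulated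
# frames along `(U′♭)^{exp(tN′)}` — then its chart velocity `w = M⁻¹G_{U′}N′` (`g(ad(−A₁))w = G_{U′}N′`) is twisted-slice tangent: **`D(logChartTwS U₀)(A₁) w = 0`**.  This is the row
# `hT : ∀ N′ w, (∀ b, M b (w b) = Gd N′ b) → Kop N′ = 0 → T w = 0` of ★w5-20520 g7's (P2-core) rows assembler ✓`Prop7LandauTransversalityPairing.hS_of_rowsZ`∕`htest_of_rows`, named «ROW-G» on the
# cell bus 2026-08-28 19:37Z∕19:56Z: ✓T4 `Prop7TwistedSliceGaugeOnto.fderiv_logChartTwS_sub_eq_zero_of_frameCorrected` at `ξ = β₀ = 0`, read through the GLUE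
# ✓`Prop7FrameResponseChartGlue.fderiv_frameTwS_apply_eq_of_chartCurve` + ✓`exists_chartCurve_of_gaugeDir` and the bondwise injectivity of the velocity map (✓`isUnit_gSer_ad_neg`).

Cell `ym3-torus`, width seat `ym3-torus-px10` (gen 2).  THEOREMS ONLY (0 `def`, 0 `sorry`).  `--supports stmt-QuantumFields-19200 --as helper`, count-neutral.  YM₃ on T³ is a
ladder rung (R3), not the Clay problem; nothing here claims the stub, the crux, d = 4 or the mass gap.

WHAT IS PROVED (sorry-free, no definition; ns `…Theorems.Prop7FrameCorrectedKernelSlice`): `gaugeDir_velocity_unique` (the chart velocity of a gauge direction is unique bondwise),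
★★★`fderiv_logChartTwS_eq_zero_of_frameCorrected_eq_zero` (ROW-G).
HONEST SCOPE: exact bookkeeping in T2 §5's setting (`hreg' : RegPr F n K ε₀′ U′` is needed by T2's characterisation); nothing of print asserted.

References: T. Bałaban, CMP 98 (1985) 17–51 [Balaban1985Averaging] ((11) p.19, (34) p.23, (97) p.32); CMP 99 (1985) 389–434 [Balaban1985BackgroundPropagators] ((3.19) p.393,
(3.114)–(3.115) p.418); CMP 102 (1985) 277–309 [Balaban1985Variational] ((44)–(49) p.285).
-/

set_option autoImplicit false

noncomputable section

open scoped BigOperators Topology Matrix.Norms.L2Operator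
open Filter NormedSpace Metric

namespace Summit.QuantumFields.YangMills.Theorems.Prop7FrameCorrectedKernelSlice

open Literature.MathematicalPhysics.QuantumFieldTheory.Balaban1983to89
open T4Continuum BlockAveraging ExpMeanLog MatrixLog
open T3ContinuumYM3Torus
open T3LevelShift (siteShift)
open T3PrintedRegularOrbits (sites_eq)
open T3SectALandauChart (bgUnits eta eta_pos)
open T3PrintedRegularMinimiser (RegPr)
open B10Eq27TorusAxialLog (gaugeActT)
open B7Prop1Explicit (expUnit val_expUnit)
open Literature.Analysis.Calculus.ExpDifferential (ad gSer)
open Summit.QuantumFields.YangMills.Theorems.Prop7SymAvgTwSym (frameAccU frameTwS frameTwS_def logChartTwS)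
open Summit.QuantumFields.YangMills.Theorems.Prop7SymAvgGL (QSym)
open B15DeterminingSets (embIter)
open Summit.QuantumFields.YangMills.Theorems.Prop7TwistedSliceTangent (hasFDerivAt_frameTwS_at_of_regPr)
open Summit.QuantumFields.YangMills.Theorems.Prop7TwistedSliceGaugeOnto (fderiv_logChartTwS_sub_eq_zero_of_frameCorrected)
open Summit.QuantumFields.YangMills.Theorems.Prop7ChartVelocityDexp (isUnit_gSer_ad_neg)
open Summit.QuantumFields.YangMills.Theorems.Prop7FrameResponseChartGlue (fderiv_frameTwS_apply_eq_of_chartCurve exists_chartCurve_of_gaugeDir)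
open Summit.QuantumFields.YangMills.Theorems.Prop7TwistedSliceGaugeOntoTower (eta_le_one)

variable (F : T3Family) {n K : ℕ} (h : n ≤ K)

/-- **THE CHART VELOCITY OF A GAUGE DIRECTION IS UNIQUE**: for `‖A₁(b)‖ ≤ ½` the velocity map `g(ad(−A₁(b)))` is invertible (✓`isUnit_gSer_ad_neg`), so two fields with the same image agree.
[cite: Balaban1985Averaging, (34) p.23] -/
theorem gaugeDir_velocity_unique (A₁ : PBond (F.P K) 0 → Matrix (Fin 2) (Fin 2) ℂ) (hA₁2 : ∀ b, ‖A₁ b‖ ≤ 1 / 2) (γ w : PBond (F.P K) 0 → Matrix (Fin 2) (Fin 2) ℂ)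
    (hγw : ∀ b, gSer ℂ (ad ℂ (-A₁ b)) (γ b) = gSer ℂ (ad ℂ (-A₁ b)) (w b)) : γ = w := by
  funext b
  have hM : IsUnit (gSer ℂ (ad ℂ (-A₁ b))) := isUnit_gSer_ad_neg (hA₁2 b)
  have h2 : ∀ Z : Matrix (Fin 2) (Fin 2) ℂ, ((hM.unit⁻¹ : (Matrix (Fin 2) (Fin 2) ℂ →L[ℂ] Matrix (Fin 2) (Fin 2) ℂ)ˣ) : Matrix (Fin 2) (Fin 2) ℂ →L[ℂ] Matrix (Fin 2) (Fin 2) ℂ)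
      (((hM.unit : (Matrix (Fin 2) (Fin 2) ℂ →L[ℂ] Matrix (Fin 2) (Fin 2) ℂ)ˣ) : Matrix (Fin 2) (Fin 2) ℂ →L[ℂ] Matrix (Fin 2) (Fin 2) ℂ) Z) = Z := by
    intro Z
    show ((hM.unit⁻¹ * hM.unit : (Matrix (Fin 2) (Fin 2) ℂ →L[ℂ] Matrix (Fin 2) (Fin 2) ℂ)ˣ) : Matrix (Fin 2) (Fin 2) ℂ →L[ℂ] Matrix (Fin 2) (Fin 2) ℂ) Z = Z
    rw [inv_mul_cancel]; rfl
  have h3 : ∀ Z : Matrix (Fin 2) (Fin 2) ℂ, (((hM.unit : (Matrix (Fin 2) (Fin 2) ℂ →L[ℂ] Matrix (Fin 2) (Fin 2) ℂ)ˣ) : Matrix (Fin 2) (Fin 2) ℂ →L[ℂ] Matrix (Fin 2) (Fin 2) ℂ) Z)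
      = gSer ℂ (ad ℂ (-A₁ b)) Z := fun Z => by rw [IsUnit.unit_spec]
  calc γ b = ((hM.unit⁻¹ : (Matrix (Fin 2) (Fin 2) ℂ →L[ℂ] Matrix (Fin 2) (Fin 2) ℂ)ˣ) : Matrix (Fin 2) (Fin 2) ℂ →L[ℂ] Matrix (Fin 2) (Fin 2) ℂ)
        (((hM.unit : (Matrix (Fin 2) (Fin 2) ℂ →L[ℂ] Matrix (Fin 2) (Fin 2) ℂ)ˣ) : Matrix (Fin 2) (Fin 2) ℂ →L[ℂ] Matrix (Fin 2) (Fin 2) ℂ) (γ b)) := (h2 _).symm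
    _ = ((hM.unit⁻¹ : (Matrix (Fin 2) (Fin 2) ℂ →L[ℂ] Matrix (Fin 2) (Fin 2) ℂ)ˣ) : Matrix (Fin 2) (Fin 2) ℂ →L[ℂ] Matrix (Fin 2) (Fin 2) ℂ)
        (((hM.unit : (Matrix (Fin 2) (Fin 2) ℂ →L[ℂ] Matrix (Fin 2) (Fin 2) ℂ)ˣ) : Matrix (Fin 2) (Fin 2) ℂ →L[ℂ] Matrix (Fin 2) (Fin 2) ℂ) (w b)) := by rw [h3, h3, hγw b]
    _ = w b := h2 _

/-- ★★★ **ROW-G: `𝓚_{A₁}N′ = 0 ⟹ D(logChartTwS U₀)(A₁)(M⁻¹G_{U′}N′) = 0`.**  In T2 §5's setting (`U₀ ∈ 𝔘_k(ε₀)`, `U′ = e^{A₁}U₀ ∈ 𝔘_k(ε₀′)`, `10¹²L³ε₀ ≤ 1`, `10⁹L²e ≤ 1`, `10⁷L³ε₀′ ≤ 1`,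
`‖A₁‖ < e·η`): let `N′` be a fine gauge parameter, `V` the real derivative of the accumulated frames `t ↦ v_k(U₀♭, (U′♭)^{exp(tN′)})(x)` at `t = 0` (GAUGE-side letter of
✓`Prop7FrameLevelOnto.exists_frameCorrected_eq`), and suppose the frame-corrected response VANISHES, `N′(x̂⁽ᵏ⁾x) − V(x)·v_k(U₀♭,U′♭)(x)⁻¹ = 0` at every top site `x`; let `w` be the chart velocity of
the gauge direction (`g(ad(−A₁(b)))w(b) = N′(b₋) − U′♭(b)N′(b₊)U′♭(b)⁻¹`).  Then `D(logChartTwS U₀)(A₁) w = 0`.  Proof: the chart curve of the orbit (GLUE §2) has velocity `w` (uniqueness),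
GLUE §1 turns `V` into the complex frame response `D(v(·)(y))(A₁)w`, and ✓T4 at `ξ = β₀ = 0` concludes. [cite: Balaban1985Averaging, (11) p.19, (97) p.32; Balaban1985BackgroundPropagators, (3.19) p.393, (3.114)-(3.115) p.418; Balaban1985Variational, (44)-(49) p.285] -/
theorem fderiv_logChartTwS_eq_zero_of_frameCorrected_eq_zero {ε₀ ε₀' e : ℝ} (hε₀ : 0 < ε₀) (he : 0 < e) (hWe : 10 ^ 9 * (F.L : ℝ) ^ 2 * e ≤ 1)
    (hWε : 10 ^ 12 * (F.L : ℝ) ^ 3 * ε₀ ≤ 1) (hε₀' : 0 < ε₀') (hε' : 10 ^ 7 * (F.L : ℝ) ^ 3 * ε₀' ≤ 1)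
    (U₀ U' : GaugeField (F.P K) 0 (Matrix.specialUnitaryGroup (Fin 2) ℂ)) (hreg : RegPr F n K ε₀ U₀) (hreg' : RegPr F n K ε₀' U')
    (A₁ : PBond (F.P K) 0 → Matrix (Fin 2) (Fin 2) ℂ) (hA₁ : ‖A₁‖ < e * eta F n K)
    (hU' : ∀ b, ((U' b : Matrix.specialUnitaryGroup (Fin 2) ℂ) : Matrix (Fin 2) (Fin 2) ℂ) = exp (A₁ b) * ((U₀ b : Matrix.specialUnitaryGroup (Fin 2) ℂ) : Matrix (Fin 2) (Fin 2) ℂ))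
    (N' : Site (F.P K) 0 → Matrix (Fin 2) (Fin 2) ℂ) (V : Site (F.P K) (K - n) → Matrix (Fin 2) (Fin 2) ℂ)
    (hV : ∀ x : Site (F.P K) (K - n), HasDerivAt (fun t : ℝ =>
      ((frameAccU (K - n) (bgUnits F K U₀) (gaugeActT (fun z : Site (F.P K) 0 => expUnit (t • N' z)) (bgUnits F K U')) x : (Matrix (Fin 2) (Fin 2) ℂ)ˣ) : Matrix (Fin 2) (Fin 2) ℂ)) (V x) 0)
    (hK0 : ∀ x : Site (F.P K) (K - n), N' (embIter (K - n) x) - V x * (((frameAccU (K - n) (bgUnits F K U₀) (bgUnits F K U') x)⁻¹ : (Matrix (Fin 2) (Fin 2) ℂ)ˣ) : Matrix (Fin 2) (Fin 2) ℂ) = 0)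
    (w : PBond (F.P K) 0 → Matrix (Fin 2) (Fin 2) ℂ)
    (hw : ∀ b, gSer ℂ (ad ℂ (-A₁ b)) (w b) = N' b.src - ((bgUnits F K U' b : (Matrix (Fin 2) (Fin 2) ℂ)ˣ) : Matrix (Fin 2) (Fin 2) ℂ) * N' b.tgt *
        (((bgUnits F K U' b)⁻¹ : (Matrix (Fin 2) (Fin 2) ℂ)ˣ) : Matrix (Fin 2) (Fin 2) ℂ)) :
    fderiv ℂ (logChartTwS F n K h U₀) A₁ w = 0 := by
  -- sizes
  have hL1 : (1 : ℝ) ≤ (F.L : ℝ) := by exact_mod_cast F.hL.2.le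
  have hA₁b : ∀ b, ‖A₁ b‖ ≤ e * eta F n K := fun b => (norm_le_pi_norm A₁ b).trans hA₁.le
  have hA₁5 : ∀ b, ‖A₁ b‖ ≤ 1 / 5 := fun b => (hA₁b b).trans (by nlinarith [eta_le_one F (n := n) (K := K), eta_pos F (n := n) (K := K), he.le])
  have hA₁2 : ∀ b, ‖A₁ b‖ ≤ 1 / 2 := fun b => (hA₁5 b).trans (by norm_num)
  -- the configuration `e^{A₁}U₀♭ = U′♭`
  have hcfg : (fun b : PBond (F.P K) 0 => expUnit (A₁ b) * bgUnits F K U₀ b) = bgUnits F K U' := by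
    funext b; apply Units.ext; rw [Units.val_mul, val_expUnit]; exact (hU' b).symm
  -- the chart curve of the orbit; its velocity is `w`
  obtain ⟨c, γ, hc0, hcd, hγ, hcg⟩ := exists_chartCurve_of_gaugeDir F U₀ U' A₁ hA₁5 hU' N'
  have hγw : γ = w := gaugeDir_velocity_unique F A₁ hA₁2 γ w fun b => by rw [hγ b, hw b]
  subst hγw
  -- T4 at `ξ = β₀ = 0`
  have hT := fderiv_logChartTwS_sub_eq_zero_of_frameCorrected F h hε₀ he hWe hWε hε₀' hε' U₀ U' hreg hreg' A₁ hA₁ hU' 0 0 γ N' (map_zero _)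
    (fun b => by simp only [Pi.zero_apply, map_zero]) hγ (fun y => ?_)
  · rwa [zero_sub, map_neg, neg_eq_zero] at hT
  · -- the frame-corrected equation at the comparison site `y`, read through the glue
    have hΦ := (hasFDerivAt_frameTwS_at_of_regPr F h hε₀ he hWe hWε U₀ hreg hA₁b y).differentiableAt
    have hVy := fderiv_frameTwS_apply_eq_of_chartCurve F h U₀ U' A₁ y hΦ hc0 hcd hcg (hV (siteShift (sites_eq F n K h) y))
    have hfr : frameTwS F n K h U₀ A₁ y = frameAccU (K - n) (bgUnits F K U₀) (bgUnits F K U') (siteShift (sites_eq F n K h) y) := by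
      rw [frameTwS_def, hcfg]
    rw [hVy, hfr, hK0, map_zero, zero_mul, neg_zero]

end Summit.QuantumFields.YangMills.Theorems.Prop7FrameCorrectedKernelSlice

end
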